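import Summits.AtomisticToContinuum.BoseEinsteinCondensation.Theorems.BECCutLineWeakDisorderGroundStateRigidityLocBddAllDensities
import Summits.AtomisticToContinuum.BoseEinsteinCondensation.Theorems.BECHardSphereReductionHardCoreDominatesMaxOccupationStability
import Summits.AtomisticToContinuum.BoseEinsteinCondensation.Theorems.BECLatticeDepthHomotopyModeIdentificationOccupationLipschitz
import Literature.MathematicalPhysics.QuantumManyBody.GroundState
import HarnessLib

/-!
# `BoundaryTransferWeak` (stmt-AtomisticToContinuum-0827), line `mode_free_reward` — piece X₂,
# the MODE-FREE RIGIDITY TRANSFER for class (a) potentials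

Supports stmt-AtomisticToContinuum-0827 (lead c6, stub `stub_modeFreeRigidityTransfer_locBdd` of the
working skeleton of `Theses.BECPeriodicReduction.BoundaryTransferWeak`).

Fixed-`N` content of piece X₂ `ModeFreeSlopeToBEC` of the mode-free reward split: at one box `(v, N, L)`,

* `maxOccupation_le_add_of_phase` — the phase-blind `λ_max`-stability
  `λ_max(γ_Ψ) ≤ λ_max(γ_Φ) + 2N ‖Ψ − cΦ‖₂` for every phase `|c| = 1` (the landed `L²`-Lipschitz bound
  `stub_maxOccupationStability` at `(Ψ, cΦ)` and phase covariance `λ_max(γ_{cΦ}) = |c|² λ_max(γ_Φ)`);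
* `le_condensateNumber_of_rigid_of_condensed` — **rigidity transfer at fixed `(v, N, L)`**: if
  near-minimisers are `L²`-rigid up to a phase (for every `η > 0` some slack `δ > 0` makes any two
  `δ`-near-minimisers `η`-close in `L²` up to a phase) and condensed competitors (`λ_max ≥ c'N`) exist at
  every slack, then `condensateNumber v N L ≥ c''N` for every `c'' < c'` (no finiteness of `E₀` needed);
* `stub_modeFreeRigidityTransfer_locBdd` — the registered stub: for `v` repulsive, finite range and
  essentially locally bounded on `(0, ∞)` the rigidity input is the landed
  `GroundStateRigidity.groundStateRigidity_of_essLocBdd_allDensities` (every density, all `N ≥ 1`), so the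
  transfer holds at EVERY density (`ρ₁ := 1` is idle) and the hypothesis `E₀ ≠ ⊤` goes unused.

References: E. H. Lieb, R. Seiringer, J. P. Solovej, J. Yngvason, *The Mathematics of the Bose Gas and its
Condensation* (2005), §1.2 (1.17)–(1.19) [LSSY2005]; M. Reed, B. Simon, *Methods of Modern Mathematical
Physics IV* (1978), §XIII.12 Thms XIII.46–47 [ReedSimonIV1978].
-/

noncomputable section

open MeasureTheory Filter
open scoped ENNReal NNReal

namespace Summit.AtomisticToContinuum.BoseEinsteinCondensation.ModeFreeReward

open Literature.MathematicalPhysics.QuantumManyBody.BoseGas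

/-- **Phase-blind `λ_max`-stability**: `λ_max(γ_Ψ) ≤ λ_max(γ_Φ) + 2N ‖Ψ − cΦ‖_{L²}` for admissible trial
states `Ψ, Φ` and every constant phase `|c| = 1` (the `L²`-Lipschitz bound at `(Ψ, cΦ)`, `cΦ` being again
admissible, and `λ_max(γ_{cΦ}) = |c|² λ_max(γ_Φ) = λ_max(γ_Φ)`). [cite: LSSY2005, §1.2 (1.17)–(1.19)] -/
theorem maxOccupation_le_add_of_phase {N : ℕ} {L : ℝ} (Ψ Φ : TrialState N L) {c : ℂ}
    (hc : ‖c‖ = 1) :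
    maxOccupation N Ψ.ψ ≤ maxOccupation N Φ.ψ +
      2 * (N : ℝ≥0∞) * (∫⁻ X, (‖Ψ.ψ X - c * Φ.ψ X‖₊ : ℝ≥0∞) ^ 2) ^ (1 / 2 : ℝ) := by
  have h := Cruxes.HardCoreDominates.Birth.stub_maxOccupationStability N L Ψ (Φ.constMul c hc)
  simpa only [TrialState.constMul_ψ, Theorems.ModeIdentification.maxOccupation_const_mul,
    coe_nnnorm_eq_one_of_norm_eq_one hc, one_pow, one_mul] using h

/-- **Rigidity transfer at fixed `(v, N, L)`**: if for every `η > 0` some slack `δ > 0` makes any two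
`δ`-near-minimisers `η`-close in `L²` up to a phase, and at every slack there is a competitor with
`λ_max ≥ c'N`, then every near-minimiser at a suitable slack has `λ_max ≥ c''N` for any `c'' < c'`
(rigidity at accuracy `((c' − c'')/2)²` and the phase-blind `2N`-Lipschitz bound
`maxOccupation_le_add_of_phase`), whence `condensateNumber v N L ≥ c''N` (`le_condensateNumber`).
[cite: LSSY2005, §1.2 (1.17)–(1.19)] -/
theorem le_condensateNumber_of_rigid_of_condensed {v : ℝ → ℝ≥0∞} {N : ℕ} {L : ℝ} {c' c'' : ℝ}
    (hlt : c'' < c')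
    (hrig : ∀ η : ℝ, 0 < η → ∃ δ : ℝ≥0∞, 0 < δ ∧ ∀ Ψ Φ : TrialState N L,
      energy v Ψ ≤ groundStateEnergy v N L + δ → energy v Φ ≤ groundStateEnergy v N L + δ →
        ∃ c : ℂ, ‖c‖ = 1 ∧ ∫⁻ X, (‖Ψ.ψ X - c * Φ.ψ X‖₊ : ℝ≥0∞) ^ 2 ≤ ENNReal.ofReal η)
    (hcomp : ∀ η : ℝ≥0∞, 0 < η → ∃ Ψ : TrialState N L,
      energy v Ψ ≤ groundStateEnergy v N L + η ∧ ENNReal.ofReal (c' * N) ≤ maxOccupation N Ψ.ψ) :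
    ENNReal.ofReal (c'' * N) ≤ condensateNumber v N L := by
  -- rigidity at accuracy `t²`, `t := (c' - c'')/2`, and a condensed competitor `Ψ` at the resulting slack
  set t : ℝ := (c' - c'') / 2 with ht
  have ht0 : 0 < t := by rw [ht]; linarith
  obtain ⟨δ, hδ, hδrig⟩ := hrig (t ^ 2) (pow_pos ht0 2)
  obtain ⟨Ψ, hΨE, hΨocc⟩ := hcomp δ hδ
  refine le_condensateNumber v hδ fun Φ hΦE => ?_
  obtain ⟨c, hc, hdist⟩ := hδrig Ψ Φ hΨE hΦE
  -- `‖Ψ - cΦ‖₂ ≤ t`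
  have hroot : (∫⁻ X, (‖Ψ.ψ X - c * Φ.ψ X‖₊ : ℝ≥0∞) ^ 2) ^ (1 / 2 : ℝ) ≤ ENNReal.ofReal t :=
    calc (∫⁻ X, (‖Ψ.ψ X - c * Φ.ψ X‖₊ : ℝ≥0∞) ^ 2) ^ (1 / 2 : ℝ)
        ≤ (ENNReal.ofReal (t ^ 2)) ^ (1 / 2 : ℝ) := ENNReal.rpow_le_rpow hdist (by norm_num)
      _ = ENNReal.ofReal t := by rw [ofReal_rpow_half_eq_sqrt (sq_nonneg t), Real.sqrt_sq ht0.le]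
  -- `c'N ≤ λ_max Ψ ≤ λ_max Φ + 2Nt = λ_max Φ + (c' - c'')N`
  have hkey : ENNReal.ofReal (c' * N) ≤ maxOccupation N Φ.ψ + ENNReal.ofReal ((c' - c'') * N) :=
    calc ENNReal.ofReal (c' * N) ≤ maxOccupation N Ψ.ψ := hΨocc
      _ ≤ maxOccupation N Φ.ψ + 2 * (N : ℝ≥0∞) * ENNReal.ofReal t :=
          (maxOccupation_le_add_of_phase Ψ Φ hc).trans (by gcongr)
      _ = maxOccupation N Φ.ψ + ENNReal.ofReal ((c' - c'') * N) := by
          rw [two_mul_natCast_mul_ofReal N t, ht]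
          congr 2
          ring
  have hnn : 0 ≤ (c' - c'') * N := mul_nonneg (by linarith) N.cast_nonneg
  calc ENNReal.ofReal (c'' * N) = ENNReal.ofReal (c' * N - (c' - c'') * N) := by congr 1; ring
    _ = ENNReal.ofReal (c' * N) - ENNReal.ofReal ((c' - c'') * N) := ENNReal.ofReal_sub _ hnn
    _ ≤ maxOccupation N Φ.ψ := tsub_le_iff_right.2 hkey

/-- **Stub 2a — mode-free rigidity transfer, class (a)** (`v` essentially locally bounded on `(0, ∞)`):
condensed competitors at every slack ⟹ every near-minimiser condensed ⟹ `condensateNumber ≥ c''N`,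
eventually in `N`, at EVERY density (the bound `ρ₁ := 1` is idle, and so is `E₀ ≠ ⊤`). The rigidity of
Dirichlet near-minimisers up to a phase is the landed class (a) theorem
`GroundStateRigidity.groundStateRigidity_of_essLocBdd_allDensities` (all `N ≥ 1`); the transfer is
`le_condensateNumber_of_rigid_of_condensed`. [cite: ReedSimonIV1978, §XIII.12 Thm XIII.47] -/
theorem stub_modeFreeRigidityTransfer_locBdd :
    ∀ v : ℝ → ℝ≥0∞, IsRepulsiveFiniteRange v →
      (∀ r : ℝ, 0 < r → ∃ C : ℝ≥0, ∀ᵐ s : ℝ, r ≤ s → v s ≤ C) → ∃ ρ₁ : ℝ, 0 < ρ₁ ∧ ∀ ρ : ℝ, 0 < ρ → ρ < ρ₁ →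
      ∀ c' c'' : ℝ, 0 < c'' → c'' < c' → ∀ᶠ N : ℕ in atTop,
        groundStateEnergy v N (sideLength ρ N) ≠ ⊤ →
        (∀ η : ℝ≥0∞, 0 < η → ∃ Ψ : TrialState N (sideLength ρ N),
          energy v Ψ ≤ groundStateEnergy v N (sideLength ρ N) + η ∧
            ENNReal.ofReal (c' * N) ≤ maxOccupation N Ψ.ψ) →
        ENNReal.ofReal (c'' * N) ≤ condensateNumber v N (sideLength ρ N) := by
  intro v hv hlb
  refine ⟨1, one_pos, fun ρ hρ _ c' c'' _ hlt => ?_⟩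
  filter_upwards [Theorems.GroundStateRigidity.groundStateRigidity_of_essLocBdd_allDensities v hv.1 hlb
    ρ hρ] with N hrig _ hcomp
  exact le_condensateNumber_of_rigid_of_condensed hlt hrig hcomp

end Summit.AtomisticToContinuum.BoseEinsteinCondensation.ModeFreeReward

end
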